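import Summits.KontsevichZagierPeriods.KontsevichZagierPeriods.Theses.HardSphereVirial

/-!
Crux-strategist sketch (cstrat stmt-KontsevichZagierPeriods-10457) — the STRENGTHEN heading of the census, typed:
`SpaceEngineSpectators` = the O(3) isotropy engine of `IsotropyFactorisation3` WITH `m` SPECTATOR COORDINATES and an
INVARIANT INTEGRAND `f` (the shape `AxialEngine`/`RotationEngine` give to the plane engine). It specialises to the crux at
`m = 0`, `f = 1`; it is what the NOT-DECOMPOSED-YET `k = 5`, `D = 3` chains of the route (B₅ of hard spheres: four points,
the fourth point = 3 spectators after the frame is fixed … iterated) would consume as a `--supports` lemma. Recorded, not filed: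
the crux itself is proved (`InverseLandau.tateLifting_isotropySpaceMove`), so no redirect is needed.
-/

noncomputable section

namespace Summit.KontsevichZagierPeriods.KontsevichZagierPeriods.Cruxes.IsotropyFactorisation3

open Literature.NumberTheory.Transcendental Literature.ModelTheory.ExponentialFields

/-- The diagonal action of `R ∈ O(3)` on the three triples `(0,1,2), (3,4,5), (6,7,8)` of `Fin (m + 9) → ℝ`,
the `m` spectator coordinates `9 … m+8` fixed. -/
def act (m : ℕ) (R : Matrix (Fin 3) (Fin 3) ℝ) (x : Fin (m + 9) → ℝ) : Fin (m + 9) → ℝ :=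
  fun i => if h : (i : ℕ) < 9 then
      (R.mulVec fun j : Fin 3 => x ⟨3 * ((i : ℕ) / 3) + (j : ℕ), by omega⟩) ⟨(i : ℕ) % 3, Nat.mod_lt _ (by norm_num)⟩
    else x i

/-- The axis section of the stereographic frame chart: `(a, b, ρ, y…) ↦ (0, 0, ρ, y…)`. -/
def axis (m : ℕ) (w : Fin (m + 9) → ℝ) : Fin (m + 9) → ℝ :=
  Function.update (Function.update w 0 0) 1 0

/-- **S⁺ (strengthening of `IsotropyFactorisation3`): the space engine with spectators and an invariant integrand.**
For every `m`, every `ℚ`-semialgebraic `σ ⊆ ℝ^{9+m}` and integrand `f`, both invariant under the diagonal `O(3)` action on the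
first three triples, `[σ, f] − [q] ∈ KZ.relations` for any representation `q` over `{w | w 2 > 0, axis w ∈ σ}` with integrand
`4 w₂²/(1 + w₀² + w₁²)² · f (axis w)` — one rule-(1a) excision of the closed southern half-axis of the first point and ONE rule-(2)
move along `Ψ(a,b,ρ,y₃,y₄,z) = (ρ ω(a,b), M(a,b) y₃, M(a,b) y₄, z)`, exactly as in the landed proof, the spectators `z` riding along
(Jacobian block `1`), the integrand transported by invariance (`f (Ψ w) = f (axis w)`). -/
def SpaceEngineSpectators : Prop :=
  ∀ (m : ℕ) (σ : Set (Fin (m + 9) → ℝ)) (f : (Fin (m + 9) → ℝ) → ℝ), IsSemialgebraic ℚ σ →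
    (∀ R : Matrix (Fin 3) (Fin 3) ℝ, R.transpose * R = 1 →
      ∀ x : Fin (m + 9) → ℝ, (x ∈ σ ↔ act m R x ∈ σ) ∧ f (act m R x) = f x) →
    ∀ (r : KZ.IntegralRep (m + 9)), r.domain = σ → (∀ x ∈ r.domain, r.integrand x = f x) →
    ∀ (q : KZ.IntegralRep (m + 9)), q.domain = {w | 0 < w 2 ∧ axis m w ∈ σ} →
      (∀ w ∈ q.domain, q.integrand w = 4 / (1 + w 0 ^ 2 + w 1 ^ 2) ^ 2 * w 2 ^ 2 * f (axis m w)) →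
      KZ.of r - KZ.of q ∈ KZ.relations

/-- Sanity of the indexing: at `m = 0` the action on the first triple is `R.mulVec (x 0, x 1, x 2)` read at index `0`. -/
example (R : Matrix (Fin 3) (Fin 3) ℝ) (x : Fin 9 → ℝ) :
    act 0 R x 0 = (R.mulVec ![x 0, x 1, x 2]) 0 := by
  simp only [act]
  simp only [Fin.isValue, Fin.val_zero, Nat.ofNat_pos, ↓reduceDIte, Nat.zero_div, mul_zero, zero_add,
    Nat.zero_mod, Fin.zero_eta]
  congr 1
  ext j
  fin_cases j <;> rfl

end Summit.KontsevichZagierPeriods.KontsevichZagierPeriods.Cruxes.IsotropyFactorisation3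

end
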